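import Summits.Ventures.HodgeRepro2.Hypothesis
import Mathlib.RingTheory.DedekindDomain.Ideal.Lemmas
import Mathlib.Algebra.BigOperators.Finprod

/-!
# HodgeRepro2 — coherent / incoherent hermitian data, nearby spaces, the reduced reflex field,
and the CM-type cut out by an imaginary element (statements, two small proofs)

Blind re-derivation cell `pub-hodge-repro2`, seat p2 (file 2; file 1 = `Hypothesis.lean`).

## Printed sources (locators as printed)

* **[Gr21]** B. Gross, *Incoherent definite spaces and Shimura varieties*, in: Relative Trace
  Formulas (Simons Symposia), Springer 2021, doi:10.1007/978-3-030-68506-5_5 (arXiv:2005.05188).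
  §3: a hermitian space over a quadratic extension `K/k` of number fields is determined by its
  local invariants — at a real place `v` of `k` complex in `K` a signature `(r_v, s_v)` with
  `ε_v = (-1)^{s_v}`, at a finite non-split `v` a class `ε_v ∈ k_v^*/N(K_v^*) = ⟨±1⟩`, `ε_v = +1`
  for almost all `v`; Theorem 3.1: a global space with given localizations exists iff
  `∏_v ε_v = +1` (Landherr), and is then unique.  §4: "Incoherent definite Hermitian data"
  = the same data, positive definite at all real places, with `∏_v ε_v = -1`.
* **[Liu21]** Y. Liu, *Fourier–Jacobi cycles and arithmetic relative trace formula*,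
  Cambridge J. Math. 9 (2021), no. 1, 1–147.  Appendix C (pp. 107–109): Definition C.1
  (reflex field and *reduced* reflex field of `(V, Φ)`), the Hodge map `h_{V,Φ}` and
  "its reflex field coincides with `E'_{V,Φ}`" (p. 108), Remark C.2 (signature `(n-1,1)` at
  `τ` and `(n,0)` elsewhere: the datum depends only on the element `τ' ∈ Φ` above `τ`, and
  "the reflex field of `h_{V,τ'}` is `τ'(E)`"), Definition C.3 (incoherent hermitian space over
  `𝔸_E`), Definition C.4 (`τ`-nearby space: same away from `τ`, signature `(n-1,1)` at `τ`),
  Proposition C.5 / Definition C.6 (the Shimura variety `Sh(𝕍)_K` over `E` whose base change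
  along `τ'` is `Sh(G(τ), h_{V(τ),τ'})_K`).  §4.2 (pp. 45–50): Definition 4.12 (`ε` is
  `μ`-admissible iff `ε_v = e N(E_v^×)` for some `e ∈ E^{×-}` with `τ'(e)` of negative
  imaginary part for every `τ' ∈ Φ_μ`), Proposition 4.13, Theorem 4.15.

## What is here
`HermitianLocalData`: the local-invariant data of [Gr21] (finite signs with finite support,
signatures at the infinite places); `IsCoherent` / `IsIncoherent` / `IsTotallyDefinite`;
`nearby d τ` ([Liu21] Def. C.4 at the level of invariants) and the proved lemma
`isCoherent_nearby`: the `τ`-nearby data of a totally definite incoherent datum is coherent.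
`reducedSig` / `reducedReflexField` ([Liu21] Def. C.1, the reflex field of the `U(V)`-datum;
the `reflexField` of `Hypothesis.lean` is the field of definition of the full Hodge-type
function, which for the brief's Galois `K` is the same field `τ₁(K)`); `ReducedReflexFieldEq`
(Remark C.2 shape).  `cmTypeOfImaginary e` = `{τ' | Im τ'(e) < 0}` and the proved lemma that
it is a CM-type when `e^ρ = -e ≠ 0` ([Liu21] Def. 4.12: the CM-type `Φ_μ` an admissible `ε`
singles out).  Nothing adelic is formalised (no `𝔸_E`-modules, no `Sh(𝕍)`).
-/

namespace Summit.Ventures.HodgeRepro2.ShimuraData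

open NumberField

noncomputable section

section LocalData

/-- [Gr21] §3–§4: the local invariants of a rank-`n` hermitian space over a CM extension `K/F`:
a sign `ε_v ∈ {±1}` at each finite place `v` of the totally real field `F` (`+1` at all but
finitely many, `+1` at split places by convention) and a signature `(r_w, s_w)` at each
infinite place `w` of `K` (one for each real place of `F`, `K` being CM). -/
structure HermitianLocalData (F K : Type*) [Field F] [NumberField F] [Field K] [NumberField K]
    (n : ℕ) where
  /-- the finite local invariants `ε_v` -/
  epsFin : IsDedekindDomain.HeightOneSpectrum (𝓞 F) → ℤˣ
  /-- `ε_v = +1` for all but finitely many `v` -/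
  epsFin_finite : Set.Finite {v | epsFin v ≠ 1}
  /-- the signatures `(r_w, s_w)` at the infinite places -/
  sig : InfinitePlace K → ℕ × ℕ
  /-- `r_w + s_w = n` -/
  sig_sum : ∀ w, (sig w).1 + (sig w).2 = n

variable {F K : Type*} [Field F] [NumberField F] [Field K] [NumberField K] {n : ℕ}

namespace HermitianLocalData

open scoped Classical

/-- [Gr21] §3: `ε_w = (-1)^{s_w}` at an infinite place. -/
def realSign (d : HermitianLocalData F K n) (w : InfinitePlace K) : ℤˣ := (-1) ^ (d.sig w).2

/-- The product of all local invariants `∏_v ε_v` (the finite product is a `finprod`). -/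
def productOfInvariants (d : HermitianLocalData F K n) : ℤˣ :=
  (∏ᶠ v, d.epsFin v) * ∏ w, d.realSign w

/-- [Gr21] Theorem 3.1: the data come from a global hermitian space iff `∏_v ε_v = +1`. -/
def IsCoherent (d : HermitianLocalData F K n) : Prop := d.productOfInvariants = 1

/-- [Gr21] §4: "incoherent" data, `∏_v ε_v = -1` ([Liu21] Def. C.3: the determinant of `𝕍`
lies in `𝔸_F^× ∖ F^× N 𝔸_E^×`). -/
def IsIncoherent (d : HermitianLocalData F K n) : Prop := d.productOfInvariants = -1

/-- Positive definite at every infinite place ([Gr21] §4 "definite", [Liu21] Def. C.3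
"totally positive definite"). -/
def IsTotallyDefinite (d : HermitianLocalData F K n) : Prop := ∀ w, (d.sig w).2 = 0

/-- [Liu21] Definition C.4 at the level of invariants: the `τ`-nearby data agree with `d` away
from `τ` and have signature `(n-1, 1)` at `τ` (here `n = m + 1`). -/
def nearby {m : ℕ} (d : HermitianLocalData F K (m + 1)) (τ : InfinitePlace K) :
    HermitianLocalData F K (m + 1) where
  epsFin := d.epsFin
  epsFin_finite := d.epsFin_finite
  sig := Function.update d.sig τ (m, 1)
  sig_sum := by
    intro w
    by_cases h : w = τ
    · subst h; simp
    · simp [Function.update_of_ne h, d.sig_sum]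

/-- The real signs of the `τ`-nearby data: `-1` at `τ`, unchanged elsewhere. -/
theorem realSign_nearby {m : ℕ} (d : HermitianLocalData F K (m + 1)) (τ : InfinitePlace K) :
    (d.nearby τ).realSign = Function.update d.realSign τ (-1) := by
  funext w
  by_cases h : w = τ
  · subst h; simp [realSign, nearby]
  · simp [realSign, nearby, Function.update_of_ne h]

/-- The `τ`-nearby data of a totally definite incoherent datum are coherent: flipping the sign at
one infinite place turns `∏_v ε_v = -1` into `+1` ([Liu21] after Def. C.4: "there exists a
hermitian space that is `τ`-nearby to `𝕍`, unique up to isomorphism", via [Gr21] Thm 3.1). -/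
theorem isCoherent_nearby {m : ℕ} (d : HermitianLocalData F K (m + 1)) (τ : InfinitePlace K)
    (hinc : d.IsIncoherent) (hdef : d.IsTotallyDefinite) : (d.nearby τ).IsCoherent := by
  unfold IsCoherent productOfInvariants
  unfold IsIncoherent productOfInvariants at hinc
  have hτ : d.realSign τ = 1 := by simp [realSign, hdef τ]
  have h1 : ∏ w, (d.nearby τ).realSign w = -∏ w, d.realSign w := by
    rw [realSign_nearby, Finset.prod_update_of_mem (Finset.mem_univ τ),
      ← Finset.mul_prod_erase Finset.univ d.realSign (Finset.mem_univ τ), hτ, one_mul,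
      Finset.sdiff_singleton_eq_erase]
    simp
  rw [show (d.nearby τ).epsFin = d.epsFin from rfl, h1, mul_neg, hinc]
  simp

end HermitianLocalData

end LocalData

section ReducedReflex

variable (K : Type*) [Field K] [NumberField K] [IsCMField K] {m : ℕ}

open scoped Classical in
/-- [Liu21] Definition C.1, the *reduced* signature `sig'_{V,Φ} = Σ_{τ∈Φ_F} q_τ τ⁻ ∈ ℕ[Φ_E]`
(`τ⁻` = the element of `Φ` above `τ`), as a function on the complex embeddings: `q_τ` at the
embedding chosen by `Φ`, `0` at the other one. -/
def reducedSig (Φ : CMTypeChoice K) (H : Matrix (Fin m) (Fin m) K) (τ : K →+* ℂ) : ℕ :=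
  if Φ.emb (InfinitePlace.mk τ) = τ then (signatureAt K τ H).2 else 0

/-- The automorphisms of `ℂ` fixing the reduced signature. -/
def reducedStabilizer (Φ : CMTypeChoice K) (H : Matrix (Fin m) (Fin m) K) : Set (ℂ ≃+* ℂ) :=
  {σ | ∀ τ : K →+* ℂ, reducedSig K Φ H ((σ : ℂ →+* ℂ).comp τ) = reducedSig K Φ H τ}

/-- [Liu21] Definition C.1: the reduced reflex field `E'_{V,Φ}` = fixed field of the stabiliser of
`sig'_{V,Φ}` in `Gal(ℂ/ℚ)`; p. 108: the Shimura datum `(Res_{F/ℚ} U(V), h_{V,Φ})` has reflex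
field `E'_{V,Φ}`.  (The `reflexField` of `Hypothesis.lean` uses the full Hodge-type function
`p_τ`/`q_τ`; for the brief's Galois `K` both are `τ₁(K)`.) -/
def reducedReflexField (Φ : CMTypeChoice K) (H : Matrix (Fin m) (Fin m) K) : Subfield ℂ :=
  ⨅ σ ∈ reducedStabilizer K Φ H, RingHom.eqLocusField (σ : ℂ →+* ℂ) (RingHom.id ℂ)

/-- [Liu21] Remark C.2 (statement shape): for signature `(n-1,1)` at `τ` and `(n,0)` at the
other places, "the reflex field of `h_{V,τ'}` is `τ'(E)`", `τ' = Φ(τ)` the chosen embedding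
above `τ`.  [DR15] §1: "a finite abelian extension of the reflex field `M`". -/
def ReducedReflexFieldEq (Φ : CMTypeChoice K) (H : Matrix (Fin m) (Fin m) K)
    (τ : InfinitePlace K) : Prop :=
  reducedReflexField K Φ H = (Φ.emb τ).fieldRange

end ReducedReflex

section ImaginaryCMType

variable (K : Type*) [Field K] [NumberField K] [IsCMField K]

/-- [Liu21] Definition 4.12: the set of complex embeddings at which a purely imaginary `e`
(`e^ρ = -e`) has negative imaginary part; `ε` is `μ`-admissible iff `Φ_μ` is contained in it for
some `e` representing `ε`. -/
def cmTypeOfImaginary (e : K) : Set (K →+* ℂ) := {τ | (τ e).im < 0}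

/-- For `e ≠ 0` with `e^ρ = -e`, exactly one of the two embeddings above each infinite place has
`Im τ(e) < 0`: `cmTypeOfImaginary e` is a CM-type (one embedding per conjugate pair). -/
theorem cmTypeOfImaginary_isCMType (e : K) (he : ρ K e = -e) (he0 : e ≠ 0) (τ : K →+* ℂ) :
    Xor (τ ∈ cmTypeOfImaginary K e)
      ((starRingEnd ℂ).comp τ ∈ cmTypeOfImaginary K e) := by
  have hconj : ((starRingEnd ℂ).comp τ) e = -(τ e) := by
    rw [RingHom.comp_apply, ← IsCMField.complexEmbedding_complexConj K τ e, he, map_neg]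
  have hre : (τ e).re = 0 := by
    have h := congrArg Complex.re hconj
    rw [RingHom.comp_apply, Complex.conj_re, Complex.neg_re] at h
    linarith
  have him : (τ e).im ≠ 0 := by
    intro h0
    apply he0
    have : τ e = 0 := Complex.ext hre h0
    exact (map_eq_zero τ).mp this
  simp only [cmTypeOfImaginary, Set.mem_setOf_eq, hconj, Complex.neg_im]
  rcases lt_or_gt_of_ne him with h | h
  · exact Or.inl ⟨h, by linarith⟩
  · exact Or.inr ⟨by linarith, by linarith⟩

end ImaginaryCMType

end

end Summit.Ventures.HodgeRepro2.ShimuraData
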